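import Literature.MathematicalPhysics.QuantumLattice.HubbardFermionInteractionTerms
import Literature.MathematicalPhysics.QuantumLattice.BdGBondHamiltonianTorus
import Literature.MathematicalPhysics.QuantumLattice.HubbardRingPerronFrobeniusProofs
import Literature.MathematicalPhysics.QuantumLattice.HubbardTorus2DEnergyDensity
import HarnessLib

/-!
# The energy density of a thermodynamic-limit state of Hubbard torus ground states

Topic `Literature/MathematicalPhysics/QuantumLattice`; namespace
`Literature.MathematicalPhysics.QuantumLattice` (the file path). Companion of
`InfVolFermionState.lean`, `HubbardFermionInteractionTerms.lean`, `InfVolFermionStateDensity.lean`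
(definition request `defn-InfVolFermionState`, route `HubbardSuperconductivity/InfiniteVolumeFirst`,
crux `NoNormalLimitState`, idea `bkr-minimiser-exclusion`, stub `TorusLimitMinimises`: "the energy
density of the limit is `lim L⁻² E₀(N_L) = energyDensity2D`"). Everything is PROVED; no
definition, no named fact.

## Results

* `fermionEmbed_toTorusEmb_hubbard_meanEnergyObs`: the mean-energy observable `E_Φ` of the
  Hubbard interaction (range `1`), pulled back into a torus of side `L ≥ 3`, is
  `U n_{0↑}n_{0↓} - (t/2) Σ_i Σ_σ (c†_0 c_{e_i} + c†_{e_i} c_0 + c†_{-e_i} c_0 + c†_0 c_{-e_i})`.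
* `sum_relabel_translate_hubbard_meanEnergyObs`: **its `L^d` translates sum to the torus Hubbard
  Hamiltonian** `hubbardTorus d L t U` (each bond is shared by its two endpoints — the factor `½`).
* `torusAvgExpect_hubbard_meanEnergyObs`: hence the translation-averaged expectation of `E_Φ` in a
  torus vector `ψ` is `⟨ψ, H ψ⟩ / L^d`.
* `InfVolFermionState.IsTorusLimitOf.hubbardEnergyDensity_eq`: the Hubbard energy density of a
  torus limit `ω` of `ψ` along `Ls → ∞` is `lim ⟨ψ_j, H ψ_j⟩/(Ls j)^d` whenever this limit exists.
* `InfVolFermionState.IsTorusLimitOf.hubbardEnergyDensity_eq_energyDensity2D`: for unit sector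
  ground states of the two-dimensional tori with `N_L = 2⌊nL²/2⌋` electrons (`U ≥ 0`,
  `0 ≤ n < 2`) the limit exists and is the thermodynamic ground-state energy density
  `energyDensity2D t U n` (`groundEnergyAt_eq_minEnergyOn_szSector`, `tendsto_energyDensity2D_torus`).

Bratteli–Robinson II §6.2.4 (mean energy of periodic states); Ruelle (1969) §3.3.

## What is NOT here

The variational (minimiser) property of torus limits among translation-invariant states of the
same density — the remaining part of `TorusLimitMinimises`.
-/

noncomputable section

namespace Literature.MathematicalPhysics.QuantumLattice

open Matrix Finset HubbardWave0 _root_.Filter Literature.Probability.LatticeModels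
open scoped _root_.Topology ComplexOrder

variable {d : ℕ}

/-! ### The unit cube `[-1,1]^d` fits into every torus of side `≥ 3` -/

/-- Points of `thicken {0} 1 = [-1,1]^d` have coordinates in `[-1, 1]`. [folklore] -/
theorem abs_apply_le_one_of_mem_thicken_one {x : Site d} (hx : x ∈ thicken ({0} : Finset (Site d)) 1)
    (j : Fin d) : |x j| ≤ 1 := by
  rw [thicken, Finset.singleton_biUnion, Nat.floor_one, mem_image] at hx
  obtain ⟨v, hv, rfl⟩ := hx
  rw [mem_box] at hv
  rw [zero_add, abs_le]
  exact_mod_cast hv j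

/-- For `L ≥ 3`, `x ↦ x mod L` is injective on `[-1,1]^d`. [folklore] -/
theorem injOn_proj_thicken_one {L : ℕ} (hL : 3 ≤ L) :
    Set.InjOn (Torus.proj (d := d) L) ↑(thicken ({0} : Finset (Site d)) 1) := by
  intro x hx y hy hxy
  refine Torus.proj_injective_of_abs_sub_lt (fun j => ?_) hxy
  have h1 := abs_apply_le_one_of_mem_thicken_one (Finset.mem_coe.1 hx) j
  have h2 := abs_apply_le_one_of_mem_thicken_one (Finset.mem_coe.1 hy) j
  have h3 : |x j - y j| ≤ |x j| + |y j| := abs_sub _ _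
  have hL' : (3 : ℤ) ≤ L := by exact_mod_cast hL
  linarith

/-- `e_i mod L` is the unit vector `Pi.single i 1` of the torus. [folklore] -/
theorem proj_unitVec (L : ℕ) (i : Fin d) : Torus.proj L (unitVec i : Site d) = Pi.single i 1 := by
  funext j
  by_cases hj : j = i
  · subst hj; simp [Torus.proj]
  · simp [Torus.proj, Pi.single_eq_of_ne hj]

/-- `(-e_i) mod L = -Pi.single i 1`. [folklore] -/
theorem proj_neg_unitVec (L : ℕ) (i : Fin d) : Torus.proj L (-unitVec i : Site d) = -Pi.single i 1 := by
  funext j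
  by_cases hj : j = i
  · subst hj; simp [Torus.proj]
  · simp [Torus.proj, Pi.single_eq_of_ne hj]

/-! ### The mean-energy observable of the Hubbard interaction pulled back into a torus -/

section TorusImage

variable (t U : ℝ) {L : ℕ} [NeZero L]

/-- **`E_Φ` in the torus**: for `L ≥ 3`, the second quantisation `Γ(ι)` of `[-1,1]^d ↪ (ℤ/Lℤ)^d`
maps the mean-energy observable of the Hubbard interaction to
`U n_{0↑}n_{0↓} + Σ_i ½·(-t) Σ_σ (c†_0 c_{e_i} + c†_{e_i} c_0 + (c†_{-e_i} c_0 + c†_0 c_{-e_i}))`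
(torus sites `ofTorusSite 0`, `ofTorusSite (±Pi.single i 1)`). [folklore] -/
theorem fermionEmbed_toTorusEmb_hubbard_meanEnergyObs (hT : Set.InjOn (Torus.proj (d := d) L)
      ↑(thicken ({0} : Finset (Site d)) 1)) :
    fermionEmbed (PolySite.toTorusEmb L hT) ((hubbardFermionInteraction d t U).meanEnergyObs 1) =
      (U : ℂ) • (numberOp (FermionTorus.ofTorusSite (0 : TorusSite d L)) 0 *
          numberOp (FermionTorus.ofTorusSite (0 : TorusSite d L)) 1) +
        ∑ i : Fin d, ((2 : ℂ)⁻¹ * -(t : ℂ)) • ∑ σ : Fin 2,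
          ((creation (orb (FermionTorus.ofTorusSite (0 : TorusSite d L)) σ) *
              annihilation (orb (FermionTorus.ofTorusSite (Pi.single i 1 : TorusSite d L)) σ) +
            creation (orb (FermionTorus.ofTorusSite (Pi.single i 1 : TorusSite d L)) σ) *
              annihilation (orb (FermionTorus.ofTorusSite (0 : TorusSite d L)) σ)) +
          (creation (orb (FermionTorus.ofTorusSite (-Pi.single i 1 : TorusSite d L)) σ) *
              annihilation (orb (FermionTorus.ofTorusSite (0 : TorusSite d L)) σ) +
            creation (orb (FermionTorus.ofTorusSite (0 : TorusSite d L)) σ) *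
              annihilation (orb (FermionTorus.ofTorusSite (-Pi.single i 1 : TorusSite d L)) σ))) := by
  have hproj0 : Torus.proj L (0 : Site d) = 0 := by funext j; simp [Torus.proj]
  -- images of the generators under `Γ(ι ∘ incl)`
  have hc : ∀ {X : Finset (Site d)} (hX : X ⊆ thicken ({0} : Finset (Site d)) 1) (x : Site d) (hx : x ∈ X)
      (σ : Fin 2),
      fermionEmbed ((PolySite.incl hX).trans (PolySite.toTorusEmb L hT)) (cAt x hx σ) =
        annihilation (orb (FermionTorus.ofTorusSite (Torus.proj L x)) σ) := by
    intro X hX x hx σ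
    rw [cAt, fermionEmbed_annihilation]
    rfl
  have hcd : ∀ {X : Finset (Site d)} (hX : X ⊆ thicken ({0} : Finset (Site d)) 1) (x : Site d) (hx : x ∈ X)
      (σ : Fin 2),
      fermionEmbed ((PolySite.incl hX).trans (PolySite.toTorusEmb L hT)) ((cAt x hx σ)ᴴ) =
        creation (orb (FermionTorus.ofTorusSite (Torus.proj L x)) σ) := by
    intro X hX x hx σ
    rw [cAt, annihilation_conjTranspose, fermionEmbed_creation]
    rfl
  have hn : ∀ {X : Finset (Site d)} (hX : X ⊆ thicken ({0} : Finset (Site d)) 1) (x : Site d) (hx : x ∈ X)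
      (σ : Fin 2),
      fermionEmbed ((PolySite.incl hX).trans (PolySite.toTorusEmb L hT)) (nAt x hx σ) =
        numberOp (FermionTorus.ofTorusSite (Torus.proj L x)) σ := by
    intro X hX x hx σ
    rw [nAt, fermionEmbed_numberOp]
    rfl
  rw [hubbardFermionInteraction_meanEnergyObs, fermionEmbed_add, fermionEmbed_sum, fermionEmbed_fermionEmbed,
    hubbardFermionInteraction_apply_singleton, fermionEmbed_smul, fermionEmbed_mul, hn, hn, hproj0]
  congr 1
  refine Finset.sum_congr rfl fun i _ => ?_
  rw [fermionEmbed_add, fermionEmbed_smul, fermionEmbed_smul, fermionEmbed_fermionEmbed, fermionEmbed_fermionEmbed,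
    hubbardFermionInteraction_apply_pair, hubbardFermionInteraction_apply_pair, fermionEmbed_smul, fermionEmbed_smul,
    fermionEmbed_sum, fermionEmbed_sum, smul_smul, smul_smul, ← smul_add, ← Finset.sum_add_distrib]
  congr 1
  refine Finset.sum_congr rfl fun σ _ => ?_
  rw [fermionEmbed_add, fermionEmbed_add, fermionEmbed_mul, fermionEmbed_mul, fermionEmbed_mul, fermionEmbed_mul,
    hc, hc, hc, hc, hcd, hcd, hcd, hcd, zero_add, neg_add_cancel, hproj0, proj_unitVec, proj_neg_unitVec]

/-- **The translates of `E_Φ` sum to the torus Hamiltonian.** For `L ≥ 3`: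
`Σ_{v ∈ (ℤ/Lℤ)^d} T_v (Γ(ι) E_Φ) T_v⁻¹ = hubbardTorus d L t U`, where `T_v = relabel (Orb.translate v)`
is the translation automorphism (every on-site term appears once; every bond `{x, x ± e_i}` of the
torus is a bond through `v` for exactly its two endpoints, each with weight `½`). Bratteli–Robinson
II §6.2.4 (periodic boundary conditions). [folklore] -/
theorem sum_relabel_translate_hubbard_meanEnergyObs (hL : 3 ≤ L) :
    ∑ v : TorusSite d L, relabel (Orb.translate v)
        (fermionEmbed (PolySite.toTorusEmb L (injOn_proj_thicken_one hL))
          ((hubbardFermionInteraction d t U).meanEnergyObs 1)) =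
      hubbardTorus d L t U := by
  -- abbreviations for the torus operators
  set o : TorusSite d L → FermionTorus d L := FermionTorus.ofTorusSite with ho
  set cd : TorusSite d L → Fin 2 → Matrix (Finset (Orb (FermionTorus d L))) (Finset (Orb (FermionTorus d L))) ℂ :=
    fun x σ => creation (orb (o x) σ) with hcd
  set c : TorusSite d L → Fin 2 → Matrix (Finset (Orb (FermionTorus d L))) (Finset (Orb (FermionTorus d L))) ℂ :=
    fun x σ => annihilation (orb (o x) σ) with hc
  set nn : TorusSite d L → Matrix (Finset (Orb (FermionTorus d L))) (Finset (Orb (FermionTorus d L))) ℂ :=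
    fun x => numberOp (o x) 0 * numberOp (o x) 1 with hnn
  -- the translate by `v` of `Γ(ι) E_Φ`
  have hcomm : ∀ (w : TorusSite d L) (i : Fin d), (Pi.single i 1 : TorusSite d L) + w = w + Pi.single i 1 :=
    fun w i => add_comm _ _
  have htrans : ∀ v : TorusSite d L, relabel (Orb.translate v)
      (fermionEmbed (PolySite.toTorusEmb L (injOn_proj_thicken_one hL))
        ((hubbardFermionInteraction d t U).meanEnergyObs 1)) =
      (U : ℂ) • nn v + ∑ i : Fin d, ((2 : ℂ)⁻¹ * -(t : ℂ)) • ∑ σ : Fin 2,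
        ((cd v σ * c (v + Pi.single i 1) σ + cd (v + Pi.single i 1) σ * c v σ) +
          (cd (v - Pi.single i 1) σ * c v σ + cd v σ * c (v - Pi.single i 1) σ)) := by
    intro v
    rw [fermionEmbed_toTorusEmb_hubbard_meanEnergyObs t U (injOn_proj_thicken_one hL), relabel_add, relabel_smul,
      relabel_mul, Orb.translate, relabel_mapEquiv_numberOp, relabel_mapEquiv_numberOp, relabel_sum]
    simp only [relabel_smul, relabel_sum, relabel_add, relabel_mul, relabel_creation, relabel_annihilation,
      Orb.mapEquiv_orb, FermionTorus.ofTorusEquiv_ofTorusSite, Equiv.coe_addRight, zero_add, neg_add_eq_sub, hcomm]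
    rfl
  simp_rw [htrans]
  rw [Finset.sum_add_distrib, ← Finset.smul_sum, Finset.sum_comm]
  -- the Hamiltonian, with all sums over `TorusSite`
  have hH : hubbardTorus d L t U =
      -(t : ℂ) • (∑ v : TorusSite d L, ∑ i : Fin d, ∑ σ : Fin 2,
          (cd v σ * c (v + Pi.single i 1) σ + cd v σ * c (v - Pi.single i 1) σ)) +
        (U : ℂ) • ∑ v : TorusSite d L, nn v := by
    rw [hubbardTorus, hamiltonian]
    congr 1
    · congr 1
      rw [← Fintype.sum_equiv FermionTorus.equivTorusSite.symm
        (fun v : TorusSite d L => ∑ i : Fin d, ∑ σ : Fin 2,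
          (cd v σ * c (v + Pi.single i 1) σ + cd v σ * c (v - Pi.single i 1) σ)) _ (fun v => ?_)]
      rw [← Fintype.sum_equiv FermionTorus.equivTorusSite.symm
        (fun w : TorusSite d L => ∑ σ : Fin 2,
          if (fermionTorusGraph d L).Adj (FermionTorus.equivTorusSite.symm v) (o w) then
            creation (orb (FermionTorus.equivTorusSite.symm v) σ) * annihilation (orb (o w) σ) else 0)
        _ (fun w => rfl)]
      have hv : (FermionTorus.equivTorusSite.symm v : FermionTorus d L) = o v := rfl
      simp_rw [hv]
      have hadj : ∀ w : TorusSite d L, (fermionTorusGraph d L).Adj (o v) (o w) ↔ (torusGraph d L).Adj v w := by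
        intro w; rw [fermionTorusGraph_adj, ho, FermionTorus.toTorusSite_ofTorusSite, FermionTorus.toTorusSite_ofTorusSite]
      have hite : ∀ w : TorusSite d L, (∑ σ : Fin 2,
          if (fermionTorusGraph d L).Adj (o v) (o w) then creation (orb (o v) σ) * annihilation (orb (o w) σ) else 0) =
          if (torusGraph d L).Adj v w then ∑ σ : Fin 2, cd v σ * c w σ else 0 := by
        intro w
        by_cases h : (torusGraph d L).Adj v w
        · rw [if_pos h]
          exact Finset.sum_congr rfl fun σ _ => by rw [if_pos ((hadj _).2 h)]
        · rw [if_neg h]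
          exact Finset.sum_eq_zero fun σ _ => by rw [if_neg (fun h' => h ((hadj _).1 h'))]
      simp_rw [hite]
      rw [sum_ite_torusGraph_adj_matrix hL v]
      simp only [Finset.sum_add_distrib]
    · congr 1
      exact (Fintype.sum_equiv FermionTorus.equivTorusSite.symm (fun v => nn v)
        (fun x : FermionTorus d L => numberOp x 0 * numberOp x 1) fun v => rfl).symm
  rw [hH, add_comm]
  congr 1
  -- the hopping part: each bond is counted twice with weight ½
  simp only [Finset.smul_sum]
  conv_rhs => rw [Finset.sum_comm]
  refine Finset.sum_congr rfl fun i _ => ?_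
  have hshift1 : ∑ v : TorusSite d L, ∑ σ : Fin 2, ((2 : ℂ)⁻¹ * -(t : ℂ)) • (cd (v + Pi.single i 1) σ * c v σ) =
      ∑ v : TorusSite d L, ∑ σ : Fin 2, ((2 : ℂ)⁻¹ * -(t : ℂ)) • (cd v σ * c (v - Pi.single i 1) σ) :=
    (TorusSite.sum_sub_shift (Pi.single i 1)
      (fun a b => ∑ σ : Fin 2, ((2 : ℂ)⁻¹ * -(t : ℂ)) • (cd a σ * c b σ))).symm
  have hshift2 : ∑ v : TorusSite d L, ∑ σ : Fin 2, ((2 : ℂ)⁻¹ * -(t : ℂ)) • (cd (v - Pi.single i 1) σ * c v σ) =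
      ∑ v : TorusSite d L, ∑ σ : Fin 2, ((2 : ℂ)⁻¹ * -(t : ℂ)) • (cd v σ * c (v + Pi.single i 1) σ) :=
    TorusSite.sum_sub_shift (Pi.single i 1)
      (fun a b => ∑ σ : Fin 2, ((2 : ℂ)⁻¹ * -(t : ℂ)) • (cd b σ * c a σ))
  simp only [smul_add, Finset.sum_add_distrib]
  rw [hshift1, hshift2]
  have ha : ((2 : ℂ)⁻¹ * -(t : ℂ)) + ((2 : ℂ)⁻¹ * -(t : ℂ)) = -(t : ℂ) := by ring
  simp only [← Finset.smul_sum]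
  conv_rhs => rw [← ha, add_smul, add_smul]
  abel

end TorusImage

/-! ### Averaged expectation and the energy density of torus limits -/

section EnergyDensity

variable (t U : ℝ)

/-- **The averaged expectation of `E_Φ` is the energy per site**: for `L ≥ 3` and a torus vector
`ψ`, the translation-averaged expectation of the Hubbard mean-energy observable in `ψ` is
`⟨ψ, H ψ⟩ / L^d`, `H = hubbardTorus d L t U`. [folklore] -/
theorem torusAvgExpect_hubbard_meanEnergyObs {L : ℕ} (hL : 3 ≤ L) (ψ : Fock (Orb (FermionTorus d L))) :
    torusAvgExpect L (thicken ({0} : Finset (Site d)) 1) ((hubbardFermionInteraction d t U).meanEnergyObs 1) ψ =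
      expect (hubbardTorus d L t U) ψ / ((L : ℂ) ^ d) := by
  haveI : NeZero L := ⟨by omega⟩
  have hT := injOn_proj_thicken_one (d := d) hL
  have hcard : Fintype.card (TorusSite d L) = L ^ d := by simp [ZMod.card, Fintype.card_fin]
  rw [torusAvgExpect_eq, torusAvgExpectAt_of_injOn L hT, hcard, Nat.cast_pow, div_eq_inv_mul]
  congr 1
  have hstep : ∀ v : TorusSite d L,
      expect (fermionEmbed (PolySite.toTorusEmb L hT) ((hubbardFermionInteraction d t U).meanEnergyObs 1))
          ((fockTranslate v).val *ᵥ ψ) =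
        expect (relabel (Orb.translate (-v))
          (fermionEmbed (PolySite.toTorusEmb L hT) ((hubbardFermionInteraction d t U).meanEnergyObs 1))) ψ := by
    intro v
    rw [expect_fockRelabel_mulVec, ← Equiv.Perm.inv_def, ← Orb.translate_neg]
  simp_rw [hstep]
  rw [Fintype.sum_equiv (Equiv.neg (TorusSite d L))
      (fun v => expect (relabel (Orb.translate (-v))
        (fermionEmbed (PolySite.toTorusEmb L hT) ((hubbardFermionInteraction d t U).meanEnergyObs 1))) ψ)
      (fun v => expect (relabel (Orb.translate v)
        (fermionEmbed (PolySite.toTorusEmb L hT) ((hubbardFermionInteraction d t U).meanEnergyObs 1))) ψ)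
      (fun v => rfl)]
  have hsum : ∀ (s : Finset (TorusSite d L))
      (f : TorusSite d L → Matrix (Finset (Orb (FermionTorus d L))) (Finset (Orb (FermionTorus d L))) ℂ),
      ∑ v ∈ s, expect (f v) ψ = expect (∑ v ∈ s, f v) ψ := by
    intro s f
    rw [expect, Matrix.sum_mulVec, dotProduct_sum]
    rfl
  rw [hsum, sum_relabel_translate_hubbard_meanEnergyObs t U hL]

/-- **The Hubbard energy density of a thermodynamic-limit state.** If `ω` is a torus limit of `ψ`
along `Ls → ∞` and the energies per site `Re⟨ψ_j, H ψ_j⟩/(Ls j)^d` (`H = hubbardTorus d (Ls j) t U`)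
converge to `e`, then `ω.hubbardEnergyDensity t U = e`. Bratteli–Robinson II §6.2.4;
Bratteli–Kishimoto–Robinson (1978) §3. [cite: BratteliKishimotoRobinson1978, §3 (mean energy functional)] -/
theorem InfVolFermionState.IsTorusLimitOf.hubbardEnergyDensity_eq {ω : InfVolFermionState d}
    {ψ : ∀ L, Fock (Orb (FermionTorus d L))} {Ls : ℕ → ℕ} (h : ω.IsTorusLimitOf ψ Ls)
    (hLs : Tendsto Ls atTop atTop) {e : ℝ}
    (he : Tendsto (fun j => (star (ψ (Ls j)) ⬝ᵥ (hubbardTorus d (Ls j) t U *ᵥ ψ (Ls j))).re / (Ls j : ℝ) ^ d)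
      atTop (𝓝 e)) :
    ω.hubbardEnergyDensity t U = e := by
  have hlim := (Complex.continuous_re.tendsto _).comp
    (h (thicken ({0} : Finset (Site d)) 1) ((hubbardFermionInteraction d t U).meanEnergyObs 1))
  refine tendsto_nhds_unique hlim (he.congr' ?_)
  filter_upwards [hLs.eventually_ge_atTop 3] with j hj
  rw [Function.comp_apply, torusAvgExpect_hubbard_meanEnergyObs t U hj, ← Complex.ofReal_natCast,
    ← Complex.ofReal_pow, Complex.div_ofReal_re]
  rfl

/-- The energy per site of a unit sector ground state of the torus `(ℤ/Lℤ)²` with `N = 2⌊nL²/2⌋`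
electrons is `E₀(N)/L²` (the `(N, S^z = 0)`-sector ground energy is the `N`-particle ground
energy, `groundEnergyAt_eq_minEnergyOn_szSector`). [cite: LiebPRL1989, proof of Theorem 1] -/
theorem re_rayleigh_hubbardTorus_of_isGroundStateInSector_rectN (L : ℕ) {n : ℝ} (hn0 : 0 ≤ n) (hn2 : n ≤ 2)
    {ψ : Fock (Orb (FermionTorus 2 L))}
    (hψ : IsGroundStateInSector (hubbardTorus 2 L t U) (ThermodynamicLimit.rectN n L) 0 ψ)
    (h1 : star ψ ⬝ᵥ ψ = 1) :
    (star ψ ⬝ᵥ (hubbardTorus 2 L t U *ᵥ ψ)).re =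
      groundEnergyAt (fermionTorusGraph 2 L) t U (ThermodynamicLimit.rectN n L) := by
  obtain ⟨-, -, hH⟩ := hψ
  have hcard : ⌊n * (L : ℝ) ^ 2 / 2⌋₊ ≤ Fintype.card (FermionTorus 2 L) := by
    have h := ThermodynamicLimit.rectN_le_two_mul hn0 hn2 L
    rw [ThermodynamicLimit.rectN] at h
    have : Fintype.card (FermionTorus 2 L) = L * L := by simp [Fintype.card_fin, sq]
    omega
  rw [hH, dotProduct_smul, h1, smul_eq_mul, mul_one, Complex.ofReal_re, ThermodynamicLimit.rectN,
    groundEnergyAt_eq_minEnergyOn_szSector _ t U hcard]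
  rfl

/-- **Torus limits of Hubbard sector ground states carry the thermodynamic energy density.**
Two dimensions, `U ≥ 0`, density `0 ≤ n < 2`: if the `ψ (Ls j)` are unit ground states of
`hubbardTorus 2 (Ls j) t U` in the sectors `(2⌊n (Ls j)²/2⌋, S^z = 0)` and `Ls → ∞`, then every
torus limit `ω` of `ψ` along `Ls` has `ω.hubbardEnergyDensity t U = energyDensity2D t U n`
(Ruelle's thermodynamic limit of the ground-state energy density, `tendsto_energyDensity2D_torus`).
[cite: Ruelle1969, §3.3] -/
theorem InfVolFermionState.IsTorusLimitOf.hubbardEnergyDensity_eq_energyDensity2D {ω : InfVolFermionState 2}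
    {ψ : ∀ L, Fock (Orb (FermionTorus 2 L))} {Ls : ℕ → ℕ} (h : ω.IsTorusLimitOf ψ Ls)
    (hLs : Tendsto Ls atTop atTop) {U : ℝ} (hU : 0 ≤ U) {n : ℝ} (hn0 : 0 ≤ n) (hn2 : n < 2)
    (hψ : ∀ j, IsGroundStateInSector (hubbardTorus 2 (Ls j) t U) (ThermodynamicLimit.rectN n (Ls j)) 0 (ψ (Ls j)))
    (h1 : ∀ j, star (ψ (Ls j)) ⬝ᵥ ψ (Ls j) = 1) :
    ω.hubbardEnergyDensity t U = ThermodynamicLimit.energyDensity2D t U n := by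
  refine h.hubbardEnergyDensity_eq t U hLs ?_
  have hlim := (ThermodynamicLimit.tendsto_energyDensity2D_torus t hU hn0 hn2).comp hLs
  refine hlim.congr' (Eventually.of_forall fun j => ?_)
  simp only [Function.comp_apply]
  rw [re_rayleigh_hubbardTorus_of_isGroundStateInSector_rectN t U (Ls j) hn0 hn2.le (hψ j) (h1 j)]

end EnergyDensity

end Literature.MathematicalPhysics.QuantumLattice

end
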